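import Summits.QuantumFields.BalabanUV.Beta.FP.ConstrainedBiLaplacianResponseTwoLevel

/-!
# `BalabanUV.Beta.FP.ConstrainedBiLaplacianSbTwoLevelSymbols` — road «FP», brick (g3) «(CONV-C)-Sb», THE TWO-LEG ONE-STEP LAW, FILE W:
# THE SUB-BLOCK WEIGHTS ARE AN EXACT PARTITION OF UNITY AND ARE `ℓ¹`-BOUNDED UNIFORMLY IN THE REFINEMENT
# (`Σ_m W1 n L (Kof k m) p = 1` for EVERY complex `p`; `Σ_m ‖W1 n L (Kof k m) p‖ ≤ 2^d` on the fat region, for EVERY `L`),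
# and the sub-cell sums of the two pure phases `EF`, `EFc` (they produce the half-weights `GP`, `GM` with `GP·GM = W1`)

NOT IN PRINT; OUR PROOF ATTEMPT (binder row G-an2-4 ∕ (CONV-C), prover part P3 = fibre∕strip «Woodbury» lineage, gen 29; CRUX TEAM (2), 2026-08-21).
HONEST DEPENDENCY (cell records, verbatim): «continuum YM on T⁴ ⇐ BetaPertH ∧ nine spine estimates (0/9 proved); BetaPertH ⇐ (D1) ∧ (D4) ∧ CAP+tail;
G-an2-4 gates asym, D1 and NE2/3/4.»  HONEST FRAMING (cell contract, verbatim): «discharging `BetaPertH` makes Bałaban's UV stability UNCONDITIONAL — a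
real constructive-QFT result; it is NOT the continuum limit and NOT the Clay problem.»  ABSOLUTE RULE (cell charter, verbatim): «No internally-minted
statement may enter as a cited fact. Every hypothesis is either kernel-proved in this package or a verbatim quotation of a PUBLISHED theorem with page
reference. The manuscript(s) under audit are NOT citable for their own disputed steps — they are the thing under adjudication; programme-internal
(2001/route/tribunal) claims are never citable.»  THIS MODULE is [folklore] trigonometric-sum algebra over the lineage's gen-22 «SUBAVG-RATE» files
(`SubAveragingDirichlet.dir`∕`ang`∕`sw`, `SubAveragingSplitting.gp`∕`gm`∕`ef_mul`∕`v_mul`, `SubAveragingCoreEstimate.W1`, `SubAveragingCore.Kof`,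
`SubAveragingKernel.Tsub`) and the vendored one-coordinate factors of [B4] (`B4StripSums.ef`∕`v`∕`F`, `ConstrainedBiLaplacianFibre.efc`∕`vc`∕`Fc`,
`ConstrainedBiLaplacianKernel.EF`∕`EFc`); cites nothing as a hypothesis; TWO bookkeeping `def`s (`GP`, `GM`), no `def … : Prop`, no `sorry`.

## Why (census V69 «SB-TWO-LEG», journal INTENT 2026-08-21): in the diagonal AND in the rank-one part of the regrouped fibre entries the
sub-cell phase sums (`GP`, `GM`, §4) PAIR with the split finer block-averaging factors into the sub-block weights `GP·GM = W1`; the tower over a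
fixed coarse scale refines with a GROWING factor, so the sums over the `L^d` sub-aliases must be controlled UNIFORMLY IN `L` (the per-pair kernel
law summed over the `k^{2d}` cell pairs is NOT summable in `d = 4`) — §1–§3: `sum_dir_mul_dir`, `sum_W1_Kof_eq_one` (= 1 exactly), `sum_norm_W1_Kof_le` (≤ 2^d).

0∕4 row-D1 binders touched.  NOT (CONV-C), NEVER «G-an2-4 closed», NOT the ghost step law, NOT SDF, NOT D1, NOT BetaPertH, NOT continuum, NOT Clay.
Provenance: prover-b2b-balaban-gan24-p3-g29-0 (unit `b2b-balaban-gan24-p3`, gen 29), 2026-08-21; no existing file touched.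
-/

noncomputable section

namespace Summit.QuantumFields.BalabanUV.Beta.FP.ConstrainedBiLaplacianSbTwoLevelSymbols

open Complex Finset ComplexConjugate
open Literature.MathematicalPhysics.QuantumFieldTheory.Balaban1983to89
open Literature.MathematicalPhysics.QuantumFieldTheory.Balaban1983to89.B4Strip
open Literature.MathematicalPhysics.QuantumFieldTheory.Balaban1983to89.B4StripCauchy
open Literature.MathematicalPhysics.QuantumFieldTheory.Balaban1983to89.B4StripSums
open Summit.QuantumFields.BalabanUV.Beta.FP.ConstrainedBiLaplacianFibre
open Summit.QuantumFields.BalabanUV.Beta.FP.ConstrainedBiLaplacianKernel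
open Summit.QuantumFields.BalabanUV.Beta.GAN24.SubAveragingDirichlet (dir dir_neg dir_apply_zero norm_dir_le ang ang_im sw)
open Summit.QuantumFields.BalabanUV.Beta.GAN24.SubAveragingSplitting (gp gm gp_mul_gm ef_mul ef_add_mul v_mul v_add_mul sum_range_mul_pow)
open Summit.QuantumFields.BalabanUV.Beta.GAN24.SubAveragingCore (Kof Kof_val fat_coord)
open Summit.QuantumFields.BalabanUV.Beta.GAN24.SubAveragingCoreEstimate (W1)
open Summit.QuantumFields.BalabanUV.Beta.GAN24.SubAveragingKernel (Tsub Tsub_val)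
open scoped Real

variable {d : ℕ}

/-! ## §1 Orthogonality of the `L`-th roots of unity -/
/-- [folklore] **ORTHOGONALITY**: for `ρ, ρ′ < L`, `Σ_{j<L} e^{2πi(ρ+ρ′+1−L)j∕L} = [ρ + ρ′ + 1 = L]·L`. -/
theorem sum_rootOfUnity_pow (L : ℕ) (hL : 1 ≤ L) {ρ ρ' : ℕ} (hρ : ρ < L) (hρ' : ρ' < L) :
    ∑ j ∈ Finset.range L, cexp (2 * π * I * (((ρ : ℂ) + ρ' + 1 - L) * j / L))
      = if ρ + ρ' + 1 = L then (L : ℂ) else 0 := by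
  have hL0 : (L : ℂ) ≠ 0 := Nat.cast_ne_zero.mpr (by omega)
  by_cases h : ρ + ρ' + 1 = L
  · rw [if_pos h]
    have e : ∀ j ∈ Finset.range L, cexp (2 * π * I * (((ρ : ℂ) + ρ' + 1 - L) * j / L)) = 1 := by
      intro j _
      have : ((ρ : ℂ) + ρ' + 1 - L) = 0 := by
        have : ((ρ + ρ' + 1 : ℕ) : ℂ) = (L : ℂ) := by rw [h]
        push_cast at this; linear_combination this
      rw [this, zero_mul, zero_div, mul_zero, Complex.exp_zero]
    rw [Finset.sum_congr rfl e, Finset.sum_const, Finset.card_range, nsmul_eq_mul, mul_one]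
  · rw [if_neg h]
    set t : ℤ := (ρ : ℤ) + ρ' + 1 - L with ht
    set ω : ℂ := cexp (2 * π * I * ((t : ℂ) / L)) with hω
    have htC : ((ρ : ℂ) + ρ' + 1 - L) = (t : ℂ) := by rw [ht]; push_cast; ring
    have e : ∀ j ∈ Finset.range L, cexp (2 * π * I * (((ρ : ℂ) + ρ' + 1 - L) * j / L)) = ω ^ j := by
      intro j _
      rw [hω, ← Complex.exp_nat_mul, htC]
      congr 1
      field_simp
    rw [Finset.sum_congr rfl e]
    have hωL : ω ^ L = 1 := by
      rw [hω, ← Complex.exp_nat_mul]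
      have : (L : ℂ) * (2 * π * I * ((t : ℂ) / L)) = t * (2 * π * I) := by field_simp
      rw [this, Complex.exp_int_mul_two_pi_mul_I]
    have hω1 : ω ≠ 1 := by
      intro h1
      rw [hω, Complex.exp_eq_one_iff] at h1
      obtain ⟨m, hm⟩ := h1
      have hmt : (t : ℂ) = (m : ℂ) * L := by
        have h2 : 2 * (π : ℂ) * I ≠ 0 := by
          have : (π : ℂ) ≠ 0 := Complex.ofReal_ne_zero.mpr Real.pi_ne_zero
          simp [Complex.I_ne_zero, this]
        field_simp at hm
        linear_combination hm
      have hmt' : t = m * L := by exact_mod_cast hmt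
      -- `t ∈ [1−L, L−1] \ {0}` cannot be a multiple of `L`
      have ht0 : t ≠ 0 := by
        intro h0; apply h; zify; linarith [h0]
      have hlt : |t| < L := by
        rw [abs_lt]; constructor <;> · push_cast [ht]; omega
      rcases lt_trichotomy m 0 with hm0 | hm0 | hm0
      · have : t ≤ -L := by
          rw [hmt']; have : m ≤ -1 := by omega
          nlinarith
        linarith [neg_abs_le t]
      · exact ht0 (by rw [hmt', hm0, zero_mul])
      · have : (L : ℤ) ≤ t := by
          rw [hmt']; have : 1 ≤ m := by omega
          nlinarith
        linarith [le_abs_self t]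
    rw [geom_sum_eq hω1, hωL, sub_self, zero_div]

/-! ## §2 The bilinear identity of the Dirichlet kernels over the `L` equally spaced angles -/
/-- [folklore] **`Σ_{j<L} dir L (α + πj∕L) · dir L (β + πj∕L) = L · dir L (α − β)`** — the sub-block weights' generating identity
(expand both kernels, sum the `j`-phases by §1: only the anti-diagonal `ρ + ρ′ = L − 1` survives, and it re-sums to `dir L (α − β)`). -/
theorem sum_dir_mul_dir (L : ℕ) (hL : 1 ≤ L) (α β : ℂ) :
    ∑ j ∈ Finset.range L, dir L (α + π * j / L) * dir L (β + π * j / L) = (L : ℂ) * dir L (α - β) := by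
  have hL0 : (L : ℂ) ≠ 0 := Nat.cast_ne_zero.mpr (by omega)
  -- expand
  have e1 : ∀ j : ℕ, dir L (α + π * j / L) * dir L (β + π * j / L)
      = ∑ ρ ∈ Finset.range L, ∑ ρ' ∈ Finset.range L,
          cexp (I * ((2 * (ρ : ℂ) - L + 1) * α) + I * ((2 * (ρ' : ℂ) - L + 1) * β))
            * cexp (2 * π * I * (((ρ : ℂ) + ρ' + 1 - L) * j / L)) := by
    intro j
    unfold dir
    rw [Finset.sum_mul_sum]
    refine Finset.sum_congr rfl fun ρ _ => Finset.sum_congr rfl fun ρ' _ => ?_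
    rw [← Complex.exp_add, ← Complex.exp_add]
    congr 1
    field_simp
    ring
  simp_rw [e1]
  rw [Finset.sum_comm]
  have e2 : ∀ ρ ∈ Finset.range L, ∑ j ∈ Finset.range L, ∑ ρ' ∈ Finset.range L,
      cexp (I * ((2 * (ρ : ℂ) - L + 1) * α) + I * ((2 * (ρ' : ℂ) - L + 1) * β))
        * cexp (2 * π * I * (((ρ : ℂ) + ρ' + 1 - L) * j / L))
      = (L : ℂ) * cexp (I * ((2 * (ρ : ℂ) - L + 1) * (α - β))) := by
    intro ρ hρ
    have hρL : ρ < L := Finset.mem_range.mp hρ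
    rw [Finset.sum_comm]
    have e3 : ∀ ρ' ∈ Finset.range L, ∑ j ∈ Finset.range L,
        cexp (I * ((2 * (ρ : ℂ) - L + 1) * α) + I * ((2 * (ρ' : ℂ) - L + 1) * β))
          * cexp (2 * π * I * (((ρ : ℂ) + ρ' + 1 - L) * j / L))
        = if ρ' = L - 1 - ρ then (L : ℂ) * cexp (I * ((2 * (ρ : ℂ) - L + 1) * α) + I * ((2 * (ρ' : ℂ) - L + 1) * β)) else 0 := by
      intro ρ' hρ'
      have hρ'L : ρ' < L := Finset.mem_range.mp hρ'
      rw [← Finset.mul_sum, sum_rootOfUnity_pow L hL hρL hρ'L]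
      by_cases h : ρ + ρ' + 1 = L
      · rw [if_pos h, if_pos (by omega)]; ring
      · rw [if_neg h, if_neg (by omega)]; ring
    rw [Finset.sum_congr rfl e3, Finset.sum_ite_eq' (Finset.range L), if_pos (Finset.mem_range.mpr (by omega))]
    congr 1
    have : ((L - 1 - ρ : ℕ) : ℂ) = (L : ℂ) - 1 - ρ := by
      rw [Nat.cast_sub (by omega), Nat.cast_sub (by omega)]; push_cast; ring
    rw [this]
    congr 1
    ring
  rw [Finset.sum_congr rfl e2, ← Finset.mul_sum]
  rfl

/-- [folklore] `conj (dir L θ) = dir L (conj θ)` (conjugation reverses the angle, and `dir` is even). -/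
theorem conj_dir (L : ℕ) (θ : ℂ) : conj (dir L θ) = dir L (conj θ) := by
  rw [← dir_neg L (conj θ)]
  unfold dir
  rw [map_sum]
  refine Finset.sum_congr rfl fun ρ _ => ?_
  rw [← Complex.exp_conj]
  congr 1
  simp only [map_mul, Complex.conj_I, map_sub, map_add, map_mul, map_natCast, map_one, map_ofNat]
  ring

/-- [folklore] **THE `ℓ²` SUM OVER THE `L` ANGLES**: `Σ_{j<L} ‖dir L (θ₀ + πj∕L)‖² ≤ 2L²` whenever `L·|Im θ₀| ≤ 1∕4`
(`= L·dir L (θ₀ − conj θ₀)` by §2 at `β = conj θ₀`, and `norm_dir_le`). -/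
theorem sum_norm_dir_sq_le (L : ℕ) (hL : 1 ≤ L) (θ₀ : ℂ) (hθ : (L : ℝ) * |θ₀.im| ≤ 1 / 4) :
    ∑ j ∈ Finset.range L, ‖dir L (θ₀ + π * j / L)‖ ^ 2 ≤ 2 * (L : ℝ) ^ 2 := by
  have hkey := sum_dir_mul_dir L hL θ₀ (conj θ₀)
  have e1 : ∀ j : ℕ, (‖dir L (θ₀ + π * j / L)‖ ^ 2 : ℝ) = (dir L (θ₀ + π * j / L) * dir L (conj θ₀ + π * j / L)).re := by
    intro j
    have hc : conj θ₀ + π * j / L = conj (θ₀ + π * j / L) := by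
      simp only [map_add, map_div₀, map_mul, Complex.conj_ofReal, map_natCast]
    rw [hc, ← conj_dir, Complex.mul_conj, Complex.normSq_eq_norm_sq]
    norm_cast
  simp_rw [e1]
  rw [← Complex.re_sum, hkey]
  have him : (L : ℝ) * |(θ₀ - conj θ₀).im| ≤ 1 / 2 := by
    have : (θ₀ - conj θ₀).im = 2 * θ₀.im := by simp; ring
    rw [this, abs_mul, abs_two]
    linarith
  have hd := norm_dir_le L (θ₀ - conj θ₀) him
  calc ((L : ℂ) * dir L (θ₀ - conj θ₀)).re ≤ ‖(L : ℂ) * dir L (θ₀ - conj θ₀)‖ := Complex.re_le_norm _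
    _ = (L : ℝ) * ‖dir L (θ₀ - conj θ₀)‖ := by rw [norm_mul, Complex.norm_natCast]
    _ ≤ (L : ℝ) * (2 * L) := mul_le_mul_of_nonneg_left hd (Nat.cast_nonneg L)
    _ = 2 * (L : ℝ) ^ 2 := by ring

/-! ## §3 The sub-block weights: exact partition of unity and the uniform `ℓ¹` bound -/

/-- [folklore] The angle of the sub-alias `k + n·j` is the base angle shifted by `πj∕L`: `ang n L (z + 2π(k + nj)) = ang n L (z + 2πk) + πj∕L`. -/
theorem ang_add_mul (n L : ℕ) (hn : 1 ≤ n) (hL : 1 ≤ L) (k j : ℕ) (z : ℂ) :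
    ang n L (z + 2 * π * ((k + n * j : ℕ) : ℂ)) = ang n L (z + 2 * π * k) + π * j / L := by
  unfold ang
  have hn0 : (n : ℂ) ≠ 0 := Nat.cast_ne_zero.mpr (by omega)
  have hL0 : (L : ℂ) ≠ 0 := Nat.cast_ne_zero.mpr (by omega)
  push_cast
  field_simp
  ring

/-- [folklore] **EXACT PARTITION OF UNITY IN ONE COORDINATE**: `Σ_{j<L} sw n L (k + n·j) z = 1` for every complex `z` (`n, L ≥ 1`). -/
theorem sum_sw_eq_one (n L : ℕ) (hn : 1 ≤ n) (hL : 1 ≤ L) (k : ℕ) (z : ℂ) :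
    ∑ j ∈ Finset.range L, sw n L (k + n * j) z = 1 := by
  have hL0 : (L : ℂ) ≠ 0 := Nat.cast_ne_zero.mpr (by omega)
  unfold sw
  simp_rw [ang_add_mul n L hn hL k _ z, sq]
  rw [← Finset.sum_div, sum_dir_mul_dir L hL, sub_self, dir_apply_zero]
  field_simp

/-- [folklore] **THE UNIFORM `ℓ¹` BOUND IN ONE COORDINATE**: `Σ_{j<L} ‖sw n L (k + n·j) z‖ ≤ 2` whenever `|Im z| ≤ 1∕2` (`n, L ≥ 1`; the bound is
free of `L`). -/
theorem sum_norm_sw_le (n L : ℕ) (hn : 1 ≤ n) (hL : 1 ≤ L) (k : ℕ) (z : ℂ) (hz : |z.im| ≤ 1 / 2) :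
    ∑ j ∈ Finset.range L, ‖sw n L (k + n * j) z‖ ≤ 2 := by
  have hL0 : (0 : ℝ) < L := by exact_mod_cast hL
  have hn0 : (0 : ℝ) < n := by exact_mod_cast hn
  set θ₀ := ang n L (z + 2 * π * k) with hθ₀
  have hθ : (L : ℝ) * |θ₀.im| ≤ 1 / 4 := by
    rw [hθ₀, ang_im]
    have : (z + 2 * ↑π * ↑k).im = z.im := by simp
    rw [this, abs_div, abs_of_pos (by positivity : (0 : ℝ) < 2 * n * L)]
    rw [show (L : ℝ) * (|z.im| / (2 * n * L)) = |z.im| / (2 * n) by field_simp]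
    rw [div_le_iff₀ (by positivity)]
    have h1n : (1 : ℝ) ≤ n := by exact_mod_cast hn
    nlinarith [abs_nonneg z.im]
  have e : ∀ j ∈ Finset.range L, ‖sw n L (k + n * j) z‖ = ‖dir L (θ₀ + π * j / L)‖ ^ 2 / (L : ℝ) ^ 2 := by
    intro j _
    unfold sw
    rw [ang_add_mul n L hn hL k j z, ← hθ₀, norm_div, norm_pow, norm_pow, Complex.norm_natCast]
  rw [Finset.sum_congr rfl e, ← Finset.sum_div, div_le_iff₀ (by positivity)]
  exact sum_norm_dir_sq_le L hL θ₀ hθ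

/-- [folklore] A sum over the sub-aliases `m ∈ (Fin L)^d` of a product over coordinates is the product of the one-coordinate sums. -/
theorem sum_prod_Kof {R : Type*} [CommSemiring R] (n L : ℕ) (k : Fin d → Fin n) (g : Fin d → ℕ → R) :
    ∑ m : Fin d → Fin L, ∏ ν, g ν ((Kof n L k m ν : Fin (n * L)) : ℕ) = ∏ ν, ∑ j ∈ Finset.range L, g ν ((k ν : ℕ) + n * j) := by
  have e : ∀ ν : Fin d, ∑ j ∈ Finset.range L, g ν ((k ν : ℕ) + n * j) = ∑ j : Fin L, g ν ((k ν : ℕ) + n * (j : ℕ)) :=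
    fun ν => (Fin.sum_univ_eq_sum_range (fun j => g ν ((k ν : ℕ) + n * j)) L).symm
  simp_rw [e]
  rw [Fintype.prod_sum]
  rfl

/-- [our proof] **THE SUB-BLOCK WEIGHTS ARE AN EXACT PARTITION OF UNITY**: `Σ_{m ∈ (Fin L)^d} W1 n L (Kof k m) p = 1` for EVERY complex `p`,
every `n, L ≥ 1`, every coarse alias `k` (hence, with `U_{nL}(Kof k m) = U_n(k)·W1(Kof k m)`, consistent with the level-wise `Σ U = 1`). -/
theorem sum_W1_Kof_eq_one (n L : ℕ) [NeZero n] [NeZero L] (k : Fin d → Fin n) (p : Fin d → ℂ) :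
    ∑ m : Fin d → Fin L, W1 n L (Kof n L k m) p = 1 := by
  have hn : 1 ≤ n := Nat.pos_of_ne_zero (NeZero.ne n)
  have hL : 1 ≤ L := Nat.pos_of_ne_zero (NeZero.ne L)
  unfold W1
  rw [sum_prod_Kof n L k (fun ν K => sw n L K (p ν))]
  simp_rw [sum_sw_eq_one n L hn hL _ _]
  simp

/-- [our proof] **THE UNIFORM `ℓ¹` BOUND OF THE SUB-BLOCK WEIGHTS**: `Σ_{m ∈ (Fin L)^d} ‖W1 n L (Kof k m) p‖ ≤ 2^d` on the fat region `Fat d r`,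
`r ≤ 1∕4` — for EVERY refinement `L ≥ 1` (the constant does not grow with `L`). -/
theorem sum_norm_W1_Kof_le (n L : ℕ) [NeZero n] [NeZero L] {r : ℝ} (hr : r ≤ 1 / 4) {p : Fin d → ℂ} (hp : p ∈ Fat d r)
    (k : Fin d → Fin n) : ∑ m : Fin d → Fin L, ‖W1 n L (Kof n L k m) p‖ ≤ 2 ^ d := by
  have hn : 1 ≤ n := Nat.pos_of_ne_zero (NeZero.ne n)
  have hL : 1 ≤ L := Nat.pos_of_ne_zero (NeZero.ne L)
  have e : ∀ m : Fin d → Fin L, ‖W1 n L (Kof n L k m) p‖ = ∏ ν, ‖sw n L ((Kof n L k m ν : Fin (n * L)) : ℕ) (p ν)‖ := by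
    intro m; unfold W1; rw [norm_prod]
  simp_rw [e]
  rw [sum_prod_Kof n L k (fun ν K => ‖sw n L K (p ν)‖)]
  calc ∏ ν, ∑ j ∈ Finset.range L, ‖sw n L ((k ν : ℕ) + n * j) (p ν)‖ ≤ ∏ _ν : Fin d, (2 : ℝ) :=
        Finset.prod_le_prod (fun ν _ => Finset.sum_nonneg fun _ _ => norm_nonneg _)
          (fun ν _ => sum_norm_sw_le n L hn hL (k ν) (p ν) (fat_coord hr hp ν).2.1)
    _ = 2 ^ d := by simp

/-! ## §4 The half-weights `GP`, `GM`, the sub-cell sums of the pure phases, and the splitting of the block-averaging factors -/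

/-- [folklore] THE PLUS HALF-WEIGHT `GP n L K p = Π_ν gp n L K_ν p_ν` (the sub-cell average of the finer `e^{+i…}` phase). -/
def GP (n L : ℕ) (K : Fin d → Fin (n * L)) (p : Fin d → ℂ) : ℂ := ∏ ν, gp n L (K ν : ℕ) (p ν)

/-- [folklore] THE MINUS HALF-WEIGHT `GM n L K p = Π_ν gm n L K_ν p_ν` (the sub-cell average of the finer `e^{−i…}` phase). -/
def GM (n L : ℕ) (K : Fin d → Fin (n * L)) (p : Fin d → ℂ) : ℂ := ∏ ν, gm n L (K ν : ℕ) (p ν)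

/-- [folklore] **`GP · GM = W1`** (coordinatewise `gp_mul_gm`). -/
theorem GP_mul_GM (n L : ℕ) [NeZero n] [NeZero L] (K : Fin d → Fin (n * L)) (p : Fin d → ℂ) :
    GP n L K p * GM n L K p = W1 n L K p := by
  have hn : 1 ≤ n := Nat.pos_of_ne_zero (NeZero.ne n)
  have hL : 1 ≤ L := Nat.pos_of_ne_zero (NeZero.ne L)
  unfold GP GM W1
  rw [← Finset.prod_mul_distrib]
  exact Finset.prod_congr rfl fun ν _ => gp_mul_gm n L hn hL _ _

/-- [folklore] one coordinate: `Σ_{j<L} ef (n·L) (k + n·m) (L·t + j) z = L · ef n k t z · gp n L (k + n·m) z`. -/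
theorem sum_ef_mul (n L : ℕ) (hn : 1 ≤ n) (hL : 1 ≤ L) (k m t : ℕ) (z : ℂ) :
    ∑ j ∈ Finset.range L, ef (n * L) (k + n * m) (L * t + j) z = (L : ℂ) * ef n k t z * gp n L (k + n * m) z := by
  have hL0 : (L : ℂ) ≠ 0 := Nat.cast_ne_zero.mpr (by omega)
  simp_rw [ef_mul n L hn hL (k + n * m) t _ z]
  rw [ef_add_mul n hn k m t z, ← Finset.mul_sum]
  unfold gp
  push_cast
  field_simp

/-- [folklore] `efc (n·L) K (L·t + j) z = efc n K t z · e^{−i(z+2πK)j∕(nL)}` (inverse of `ef_mul`). -/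
theorem efc_mul (n L : ℕ) (hn : 1 ≤ n) (hL : 1 ≤ L) (K t j : ℕ) (z : ℂ) :
    efc (n * L) K (L * t + j) z = efc n K t z * cexp (-(I * (z + 2 * π * K) * j / (n * L))) := by
  rw [efc_eq_inv, efc_eq_inv, ef_mul n L hn hL K t j z, mul_inv, Complex.exp_neg]

/-- [folklore] `efc n (k + n·m) t z = efc n k t z`. -/
theorem efc_add_mul (n : ℕ) (hn : 1 ≤ n) (k m t : ℕ) (z : ℂ) : efc n (k + n * m) t z = efc n k t z := by
  rw [efc_eq_inv, efc_eq_inv, ef_add_mul n hn]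

/-- [folklore] one coordinate: `Σ_{j<L} efc (n·L) (k + n·m) (L·t + j) z = L · efc n k t z · gm n L (k + n·m) z`. -/
theorem sum_efc_mul (n L : ℕ) (hn : 1 ≤ n) (hL : 1 ≤ L) (k m t : ℕ) (z : ℂ) :
    ∑ j ∈ Finset.range L, efc (n * L) (k + n * m) (L * t + j) z = (L : ℂ) * efc n k t z * gm n L (k + n * m) z := by
  have hL0 : (L : ℂ) ≠ 0 := Nat.cast_ne_zero.mpr (by omega)
  simp_rw [efc_mul n L hn hL (k + n * m) t _ z]
  rw [efc_add_mul n hn k m t z, ← Finset.mul_sum]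
  unfold gm
  push_cast
  field_simp

/-- [our proof] **THE SUB-CELL SUM OF THE FINER PLUS PHASE**: `Σ_ρ EF (n·L) (Tsub τ ρ) (Kof k m) p = L^d · EF n τ k p · GP n L (Kof k m) p`. -/
theorem sum_EF_Tsub (n L : ℕ) [NeZero n] [NeZero L] (τ k : Fin d → Fin n) (m : Fin d → Fin L) (p : Fin d → ℂ) :
    ∑ ρ : Fin d → Fin L, EF (n * L) (Tsub n L τ ρ) (Kof n L k m) p = (L : ℂ) ^ d * (EF n τ k p * GP n L (Kof n L k m) p) := by
  have hn : 1 ≤ n := Nat.pos_of_ne_zero (NeZero.ne n)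
  have hL : 1 ≤ L := Nat.pos_of_ne_zero (NeZero.ne L)
  unfold EF GP
  rw [← Finset.prod_mul_distrib]
  have e1 : (∑ ρ : Fin d → Fin L, ∏ ν, ef (n * L) ((Kof n L k m ν : Fin (n * L)) : ℕ) ((Tsub n L τ ρ ν : Fin (n * L)) : ℕ) (p ν))
      = ∏ ν, ∑ j : Fin L, ef (n * L) ((k ν : ℕ) + n * (m ν : ℕ)) (L * (τ ν : ℕ) + (j : ℕ)) (p ν) := by
    rw [Fintype.prod_sum]
    rfl
  rw [e1]
  have e2 : ∀ ν : Fin d, ∑ j : Fin L, ef (n * L) ((k ν : ℕ) + n * (m ν : ℕ)) (L * (τ ν : ℕ) + (j : ℕ)) (p ν)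
      = (L : ℂ) * (ef n (k ν : ℕ) (τ ν : ℕ) (p ν) * gp n L ((Kof n L k m ν : Fin (n * L)) : ℕ) (p ν)) := by
    intro ν
    rw [Fin.sum_univ_eq_sum_range (fun j => ef (n * L) ((k ν : ℕ) + n * (m ν : ℕ)) (L * (τ ν : ℕ) + j) (p ν)) L,
      sum_ef_mul n L hn hL, Kof_val, mul_assoc]
  simp_rw [e2]
  rw [Finset.prod_mul_distrib, Finset.prod_const, Finset.card_univ, Fintype.card_fin]

/-- [our proof] **THE SUB-CELL SUM OF THE FINER MINUS PHASE**: `Σ_ρ EFc (n·L) (Tsub σ ρ) (Kof k m) p = L^d · EFc n σ k p · GM n L (Kof k m) p`. -/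
theorem sum_EFc_Tsub (n L : ℕ) [NeZero n] [NeZero L] (σ k : Fin d → Fin n) (m : Fin d → Fin L) (p : Fin d → ℂ) :
    ∑ ρ : Fin d → Fin L, EFc (n * L) (Tsub n L σ ρ) (Kof n L k m) p = (L : ℂ) ^ d * (EFc n σ k p * GM n L (Kof n L k m) p) := by
  have hn : 1 ≤ n := Nat.pos_of_ne_zero (NeZero.ne n)
  have hL : 1 ≤ L := Nat.pos_of_ne_zero (NeZero.ne L)
  unfold EFc GM
  rw [← Finset.prod_mul_distrib]
  have e1 : (∑ ρ : Fin d → Fin L, ∏ ν, efc (n * L) ((Kof n L k m ν : Fin (n * L)) : ℕ) ((Tsub n L σ ρ ν : Fin (n * L)) : ℕ) (p ν))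
      = ∏ ν, ∑ j : Fin L, efc (n * L) ((k ν : ℕ) + n * (m ν : ℕ)) (L * (σ ν : ℕ) + (j : ℕ)) (p ν) := by
    rw [Fintype.prod_sum]
    rfl
  rw [e1]
  have e2 : ∀ ν : Fin d, ∑ j : Fin L, efc (n * L) ((k ν : ℕ) + n * (m ν : ℕ)) (L * (σ ν : ℕ) + (j : ℕ)) (p ν)
      = (L : ℂ) * (efc n (k ν : ℕ) (σ ν : ℕ) (p ν) * gm n L ((Kof n L k m ν : Fin (n * L)) : ℕ) (p ν)) := by
    intro ν
    rw [Fin.sum_univ_eq_sum_range (fun j => efc (n * L) ((k ν : ℕ) + n * (m ν : ℕ)) (L * (σ ν : ℕ) + j) (p ν)) L,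
      sum_efc_mul n L hn hL, Kof_val, mul_assoc]
  simp_rw [e2]
  rw [Finset.prod_mul_distrib, Finset.prod_const, Finset.card_univ, Fintype.card_fin]

/-- [folklore] **SPLITTING OF THE CONJUGATE BLOCK-AVERAGING FACTOR**: `vc (n·L) K z = gp n L K z · vc n K z`. -/
theorem vc_mul (n L : ℕ) (hn : 1 ≤ n) (hL : 1 ≤ L) (K : ℕ) (z : ℂ) : vc (n * L) K z = gp n L K z * vc n K z := by
  have hL' : (L : ℂ) ≠ 0 := Nat.cast_ne_zero.mpr (by omega)
  have hn' : (n : ℂ) ≠ 0 := Nat.cast_ne_zero.mpr (by omega)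
  unfold vc gp
  simp_rw [ef_eq_pow]
  rw [sum_range_mul_pow]
  have e1 : cexp (I * (z + 2 * ↑π * ↑K) / ↑(n * L)) ^ L = cexp (I * (z + 2 * π * K) / n) := by
    rw [← Complex.exp_nat_mul]; congr 1; push_cast; field_simp
  have e2 : ∀ b : ℕ, cexp (I * (z + 2 * ↑π * ↑K) / ↑(n * L)) ^ b = cexp (I * (z + 2 * π * K) * b / (n * L)) := by
    intro b; rw [← Complex.exp_nat_mul]; congr 1; push_cast; ring
  rw [e1]
  simp_rw [e2]
  push_cast
  field_simp

/-- [folklore] `vc n (k + n·m) z = vc n k z`. -/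
theorem vc_add_mul (n : ℕ) (hn : 1 ≤ n) (k m : ℕ) (z : ℂ) : vc n (k + n * m) z = vc n k z := by
  unfold vc; simp_rw [ef_add_mul n hn k m _ z]

/-- [our proof] **THE FINER BLOCK-AVERAGING FACTOR SPLITS OFF THE MINUS HALF-WEIGHT**: `F (n·L) 0 (Kof k m) p = GM n L (Kof k m) p · F n 0 k p`. -/
theorem F_zero_Kof (n L : ℕ) [NeZero n] [NeZero L] (k : Fin d → Fin n) (m : Fin d → Fin L) (p : Fin d → ℂ) :
    F (n * L) (fun _ => 0) (Kof n L k m) p = GM n L (Kof n L k m) p * F n (fun _ => 0) k p := by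
  have hn : 1 ≤ n := Nat.pos_of_ne_zero (NeZero.ne n)
  have hL : 1 ≤ L := Nat.pos_of_ne_zero (NeZero.ne L)
  unfold F GM
  rw [← Finset.prod_mul_distrib]
  refine Finset.prod_congr rfl fun ν _ => ?_
  have h1 : ef (n * L) ((Kof n L k m ν : Fin (n * L)) : ℕ) ((fun _ => (0 : Fin (n * L))) ν : ℕ) (p ν) = 1 := by unfold ef; simp
  have h2 : ef n (k ν : ℕ) ((fun _ => (0 : Fin n)) ν : ℕ) (p ν) = 1 := by unfold ef; simp
  rw [h1, h2, one_mul, one_mul, Kof_val, v_mul n L hn hL, v_add_mul n hn]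

/-- [our proof] **THE FINER CONJUGATE FACTOR SPLITS OFF THE PLUS HALF-WEIGHT**: `Fc (n·L) 0 (Kof k m) p = GP n L (Kof k m) p · Fc n 0 k p`. -/
theorem Fc_zero_Kof (n L : ℕ) [NeZero n] [NeZero L] (k : Fin d → Fin n) (m : Fin d → Fin L) (p : Fin d → ℂ) :
    Fc (n * L) (fun _ => 0) (Kof n L k m) p = GP n L (Kof n L k m) p * Fc n (fun _ => 0) k p := by
  have hn : 1 ≤ n := Nat.pos_of_ne_zero (NeZero.ne n)
  have hL : 1 ≤ L := Nat.pos_of_ne_zero (NeZero.ne L)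
  unfold Fc GP
  rw [← Finset.prod_mul_distrib]
  refine Finset.prod_congr rfl fun ν _ => ?_
  have h1 : efc (n * L) ((Kof n L k m ν : Fin (n * L)) : ℕ) ((fun _ => (0 : Fin (n * L))) ν : ℕ) (p ν) = 1 := by unfold efc; simp
  have h2 : efc n (k ν : ℕ) ((fun _ => (0 : Fin n)) ν : ℕ) (p ν) = 1 := by unfold efc; simp
  rw [h1, h2, one_mul, one_mul, Kof_val, vc_mul n L hn hL, vc_add_mul n hn]

end Summit.QuantumFields.BalabanUV.Beta.FP.ConstrainedBiLaplacianSbTwoLevelSymbols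

end
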